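import Literature.AlgebraicGeometry.Shioda1982.ExceptionalQuadruplesSweepFiveHundredNinetyFourPartOne
import Literature.AlgebraicGeometry.Shioda1982.ExceptionalQuadruplesSweepFiveHundredNinetyFourPartTwo
import Literature.AlgebraicGeometry.Shioda1982.ExceptionalQuadruplesSweepFiveHundredNinetyFourPartThree
import Literature.AlgebraicGeometry.Shioda1982.ExceptionalQuadruplesSweepFiveHundredNinetyFourPartFour
import Literature.AlgebraicGeometry.Shioda1982.ExceptionalQuadruplesSweepFiveHundredNinetyFourPartFive
import Literature.AlgebraicGeometry.Shioda1982.ExceptionalQuadruplesSweepFiveHundredNinetyFourPartSix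
import Literature.AlgebraicGeometry.Shioda1982.ExceptionalQuadruplesSweepFiveHundredNinetyFourPartSeven
import Literature.AlgebraicGeometry.Shioda1982.ExceptionalQuadruplesSweepFiveHundredNinetyFourPartEight
import Literature.AlgebraicGeometry.Shioda1982.ExceptionalQuadruplesSweepFiveHundredNinetyFourPartNine
import Literature.AlgebraicGeometry.Shioda1982.ExceptionalQuadruplesSweepFiveHundredNinetyFourPartTen
import Literature.AlgebraicGeometry.Shioda1982.ExceptionalQuadruplesSweepFiveHundredNinetyFourPartEleven
import Literature.AlgebraicGeometry.Shioda1982.ExceptionalQuadruplesSweepFiveHundredNinetyFourPartTwelve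
import Literature.AlgebraicGeometry.Shioda1982.ExceptionalQuadruplesSweepFiveHundredNinetyFourPartThirteen
import Literature.AlgebraicGeometry.Shioda1982.ExceptionalQuadruplesSweepFiveHundredNinetyFourPartFourteen
import Literature.AlgebraicGeometry.Shioda1982.ExceptionalQuadruplesSweepFiveHundredNinetyFourPartFifteen
import Literature.AlgebraicGeometry.Shioda1982.ExceptionalQuadruplesSweepFiveHundredNinetyFourPartSixteen
import Literature.AlgebraicGeometry.Shioda1982.ExceptionalQuadruplesSweepFiveHundredNinetyFourPartSeventeen
import Literature.AlgebraicGeometry.Shioda1982.ExceptionalQuadruplesSweepFiveHundredNinetyFourPartEighteen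
import Literature.AlgebraicGeometry.Shioda1982.ExceptionalQuadruplesSweepFiveHundredNinetyFourPartNineteen
import Literature.AlgebraicGeometry.Shioda1982.ExceptionalQuadruplesSweepFiveHundredNinetyFourPartTwenty
import Literature.AlgebraicGeometry.Shioda1982.ExceptionalQuadruplesSweepFiveHundredNinetyFourPartTwentyOne
import Literature.AlgebraicGeometry.Shioda1982.ExceptionalQuadruplesSweepFiveHundredNinetyFourPartTwentyTwo
import Literature.AlgebraicGeometry.Shioda1982.ExceptionalQuadruplesSweepFiveHundredNinetyFourPartTwentyThree
import Literature.AlgebraicGeometry.Shioda1982.ExceptionalQuadruplesSweepFiveHundredNinetyFourPartTwentyFour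
import Literature.AlgebraicGeometry.Shioda1982.ExceptionalQuadruplesSweepFiveHundredNinetyFourPartTwentyFive
import Literature.AlgebraicGeometry.Shioda1982.ExceptionalQuadruplesSweepFiveHundredNinetyFourPartTwentySix
import HarnessLib

/-!
# Shioda 1982 / Meyer–Neutsch 1981: no exceptional quadruple at the level `N = 594` — kernel sweep, part 27 of 27 and assembly

Topic `Literature/AlgebraicGeometry/Shioda1982`; companion of `ExceptionalQuadruplesComplete.lean` (search `checkB`, soundness
`tabelleOneCompleteAt_of_chunks`, invariant form `exists_mem_reps_of_isExceptionalQuadruple`, statement `TabelleOneCompleteAt`; sources,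
method and framing in its module docstring) and of the series `ExceptionalQuadruplesSweep*.lean` (together: every level `2 ≤ N ≤ 180`
that is not a row of Tabelle 1; `…SweepTwoHundredTwenty/…TwoHundredSixty/…ThreeHundredForty.lean`,
`…SweepTwoHundredFiftyTwo/…ThreeHundredNinetySix/…FourHundredSixtyEight.lean`, `…SweepTwoHundred.lean`: the levels `220, 260, 340`, `252, 396, 468`
and `200` of the families `20p`, `36p`, `40p`; `…Sweep<Level>[Part<K>].lean` for the `{2,3,5,7}`-smooth residual levels
`189, 192, 210, 216, 224, 240, 270, 288, 300, 315, 320, 324, 336, 360, 378, 384, 405, 420, 432, 448` `480 … 630`, and the last three levels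
`450, 594, 612` of `(180, 630]` outside the ranges of the tree's character-sum families). THEOREMS only (no definition, no named fact): the same kernel
search at the single level `N = 594`, which carries NO row of [MeyerNeutsch1981Fermatquadrupel, Tabelle 1] (computer-generated there,
"alle Fermatquadrupel für N ≤ 614 ermittelt", §2 p. 53) and lies above the range `N ≤ 180` of Shioda's table p. 727 — by Aoki's
Theorem C ([Aoki1983], computer-assisted for `181 ≤ m ≤ 672`) there is no exceptional element at any level `> 180`; the files
`ExceptionalQuadruplesSweepFiveHundredNinetyFourPartOne.lean`, `ExceptionalQuadruplesSweepFiveHundredNinetyFourPartTwo.lean`, `ExceptionalQuadruplesSweepFiveHundredNinetyFourPartThree.lean`, `ExceptionalQuadruplesSweepFiveHundredNinetyFourPartFour.lean`, `ExceptionalQuadruplesSweepFiveHundredNinetyFourPartFive.lean`, `ExceptionalQuadruplesSweepFiveHundredNinetyFourPartSix.lean`, `ExceptionalQuadruplesSweepFiveHundredNinetyFourPartSeven.lean`, `ExceptionalQuadruplesSweepFiveHundredNinetyFourPartEight.lean`, `ExceptionalQuadruplesSweepFiveHundredNinetyFourPartNine.lean`, `ExceptionalQuadruplesSweepFiveHundredNinetyFourPartTen.lean`,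 `ExceptionalQuadruplesSweepFiveHundredNinetyFourPartEleven.lean`, `ExceptionalQuadruplesSweepFiveHundredNinetyFourPartTwelve.lean`, `ExceptionalQuadruplesSweepFiveHundredNinetyFourPartThirteen.lean`, `ExceptionalQuadruplesSweepFiveHundredNinetyFourPartFourteen.lean`, `ExceptionalQuadruplesSweepFiveHundredNinetyFourPartFifteen.lean`, `ExceptionalQuadruplesSweepFiveHundredNinetyFourPartSixteen.lean`, `ExceptionalQuadruplesSweepFiveHundredNinetyFourPartSeventeen.lean`, `ExceptionalQuadruplesSweepFiveHundredNinetyFourPartEighteen.lean`, `ExceptionalQuadruplesSweepFiveHundredNinetyFourPartNineteen.lean`, `ExceptionalQuadruplesSweepFiveHundredNinetyFourPartTwenty.lean`, `ExceptionalQuadruplesSweepFiveHundredNinetyFourPartTwentyOne.lean`, `ExceptionalQuadruplesSweepFiveHundredNinetyFourPartTwentyTwo.lean`, `ExceptionalQuadruplesSweepFiveHundredNinetyFourPartTwentyThree.lean`, `ExceptionalQuadruplesSweepFiveHundredNinetyFourPartTwentyFour.lean`, `ExceptionalQuadruplesSweepFiveHundredNinetyFourPartTwentyFive.lean`, `ExceptionalQuadruplesSweepFiveHundredNinetyFourPartTwentySix.lean`,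 `ExceptionalQuadruplesSweepFiveHundredNinetyFour.lean` make the instance `N = 594` a kernel statement. The search at
`N = 594` visits 5865948 candidate triples (`φ(594) − 1 = 179` units each), too many for one elaboration of bounded wall time, so the
chunks of first entries are spread over 27 files: `ExceptionalQuadruplesSweepFiveHundredNinetyFourPartOne.lean` — first entries `0 ≤ a < 7` (207837 candidates);
`ExceptionalQuadruplesSweepFiveHundredNinetyFourPartTwo.lean` — first entries `7 ≤ a < 14` (212153 candidates);
`ExceptionalQuadruplesSweepFiveHundredNinetyFourPartThree.lean` — first entries `14 ≤ a < 21` (215840 candidates);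
`ExceptionalQuadruplesSweepFiveHundredNinetyFourPartFour.lean` — first entries `21 ≤ a < 28` (218899 candidates);
`ExceptionalQuadruplesSweepFiveHundredNinetyFourPartFive.lean` — first entries `28 ≤ a < 35` (221328 candidates);
`ExceptionalQuadruplesSweepFiveHundredNinetyFourPartSix.lean` — first entries `35 ≤ a < 42` (223129 candidates);
`ExceptionalQuadruplesSweepFiveHundredNinetyFourPartSeven.lean` — first entries `42 ≤ a < 48` (192210 candidates);
`ExceptionalQuadruplesSweepFiveHundredNinetyFourPartEight.lean` — first entries `48 ≤ a < 55` (224805 candidates);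
`ExceptionalQuadruplesSweepFiveHundredNinetyFourPartNine.lean` — first entries `55 ≤ a < 62` (224809 candidates);
`ExceptionalQuadruplesSweepFiveHundredNinetyFourPartTen.lean` — first entries `62 ≤ a < 69` (224184 candidates);
`ExceptionalQuadruplesSweepFiveHundredNinetyFourPartEleven.lean` — first entries `69 ≤ a < 76` (222931 candidates);
`ExceptionalQuadruplesSweepFiveHundredNinetyFourPartTwelve.lean` — first entries `76 ≤ a < 82` (189609 candidates);
`ExceptionalQuadruplesSweepFiveHundredNinetyFourPartThirteen.lean` — first entries `82 ≤ a < 89` (218934 candidates);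
`ExceptionalQuadruplesSweepFiveHundredNinetyFourPartFourteen.lean` — first entries `89 ≤ a < 96` (215884 candidates);
`ExceptionalQuadruplesSweepFiveHundredNinetyFourPartFifteen.lean` — first entries `96 ≤ a < 104` (242183 candidates);
`ExceptionalQuadruplesSweepFiveHundredNinetyFourPartSixteen.lean` — first entries `104 ≤ a < 111` (207230 candidates);
`ExceptionalQuadruplesSweepFiveHundredNinetyFourPartSeventeen.lean` — first entries `111 ≤ a < 119` (230643 candidates);
`ExceptionalQuadruplesSweepFiveHundredNinetyFourPartEighteen.lean` — first entries `119 ≤ a < 126` (195689 candidates);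
`ExceptionalQuadruplesSweepFiveHundredNinetyFourPartNineteen.lean` — first entries `126 ≤ a < 134` (215803 candidates);
`ExceptionalQuadruplesSweepFiveHundredNinetyFourPartTwenty.lean` — first entries `134 ≤ a < 143` (231658 candidates);
`ExceptionalQuadruplesSweepFiveHundredNinetyFourPartTwentyOne.lean` — first entries `143 ≤ a < 152` (218597 candidates);
`ExceptionalQuadruplesSweepFiveHundredNinetyFourPartTwentyTwo.lean` — first entries `152 ≤ a < 161` (204199 candidates);
`ExceptionalQuadruplesSweepFiveHundredNinetyFourPartTwentyThree.lean` — first entries `161 ≤ a < 172` (228075 candidates);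
`ExceptionalQuadruplesSweepFiveHundredNinetyFourPartTwentyFour.lean` — first entries `172 ≤ a < 184` (219135 candidates);
`ExceptionalQuadruplesSweepFiveHundredNinetyFourPartTwentyFive.lean` — first entries `184 ≤ a < 198` (212407 candidates);
`ExceptionalQuadruplesSweepFiveHundredNinetyFourPartTwentySix.lean` — first entries `198 ≤ a < 218` (218088 candidates);
`ExceptionalQuadruplesSweepFiveHundredNinetyFour.lean` — first entries `218 ≤ a < 594` (229689 candidates); the last one assembles
`completeAt_fiveHundredNinetyFour` (every sorted pair-free primitive Hodge 4-multiset mod `594` is standard) and `not_isExceptionalQuadruple_fiveHundredNinetyFour`.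
WHY THIS LEVEL (cell `pub-hfermat`): `594 = 2·3³·11`: the tree's character-sum families cover the levels `K·p`, `p` a prime above a bound depending on `K`, for
`K ∈ {2, 3, 4, 6, 8, 9, 10, 12, 18, 20, 24, 36, 40}` or `K` a power of `2` or of `3` (`PicardNumber<K>Prime.lean`, `PicardNumberTwoPowerPrime.lean`,
`PicardNumberThreePowPrime.lean`) and the prime-power levels (`PicardNumberPrimePower.lean`); writing `594 = K·p` with `p` prime forces
`K ∈ {54, 198, 297}`, none of them among those `K`. `decide +kernel` only (no `native_decide`).

HONEST FRAMING (cell `pub-hfermat`): explicit algebraic cycles for specific Hodge classes on Fermat/Delsarte varieties; residual open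
instances listed; no claim on general Hodge. These classes are algebraic (Lefschetz (1,1)); certified here is only the emptiness of the
exceptional list at this level.

## References
* [MeyerNeutsch1981Fermatquadrupel] W. Meyer, W. Neutsch, *Fermatquadrupel*, Math. Ann. 256 (1981) 51–62, §2 p. 53, Tabelle 1 p. 54 (no row 594).
* [Shioda1982PicardFermat] T. Shioda, J. Fac. Sci. Univ. Tokyo IA 28 (1982) 725–734, table p. 727 (levels `≤ 180`), Prop. 4 (Q′) p. 729.
* [Aoki1983] N. Aoki, Math. Ann. 266 (1983) 23–54, Thm. C.
-/

namespace Literature.AlgebraicGeometry.Shioda1982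

open Literature.AlgebraicGeometry.HodgeTheory

set_option maxHeartbeats 0 in
/-- **The search at `N = 594` passes on the first entries `218 ≤ a < 594`** (part 27 of 27: 15 chunks, 229689 candidate
triples): every visited sorted quadruple of representatives there fails the Hodge test or is standard (`checkB`; `reps 594 = []`).
[cite: MeyerNeutsch1981Fermatquadrupel, §2 p. 53 ("alle Fermatquadrupel für N ≤ 614 ermittelt") and Tabelle 1 p. 54 (no row 594)]
[cite: Aoki1983, Thm. C] -/
theorem checkB_fiveHundredNinetyFour_partTwentySeven :
    ∀ p ∈ ([(218, 2), (220, 2), (222, 2), (224, 2), (226, 2), (228, 2), (230, 3), (233, 3), (236, 3), (239, 4), (243, 4), (247, 5), (252, 7), (259, 12), (271, 323)] : List (ℕ × ℕ)), checkB 594 p.1 p.2 = true := by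
  intro p hp
  simp only [List.mem_cons, List.not_mem_nil, or_false] at hp
  rcases hp with rfl | rfl | rfl | rfl | rfl | rfl | rfl | rfl | rfl | rfl | rfl | rfl | rfl | rfl | rfl <;> decide +kernel

set_option maxHeartbeats 0 in
/-- **Tabelle 1 is complete at `N = 594`, where it is empty**: every sorted Hodge 4-multiset mod `594` without a pair and with
`gcd = 1` is standard. Kernel exhaustion (`checkB`, 232 chunks of first entries in 27 files, 5865948 candidate triples:
`checkB_fiveHundredNinetyFour_partOne`, `checkB_fiveHundredNinetyFour_partTwo`, `checkB_fiveHundredNinetyFour_partThree`, `checkB_fiveHundredNinetyFour_partFour`, `checkB_fiveHundredNinetyFour_partFive`, `checkB_fiveHundredNinetyFour_partSix`, `checkB_fiveHundredNinetyFour_partSeven`, `checkB_fiveHundredNinetyFour_partEight`, `checkB_fiveHundredNinetyFour_partNine`, `checkB_fiveHundredNinetyFour_partTen`, `checkB_fiveHundredNinetyFour_partEleven`, `checkB_fiveHundredNinetyFour_partTwelve`, `checkB_fiveHundredNinetyFour_partThirteen`, `checkB_fiveHundredNinetyFour_partFourteen`, `checkB_fiveHundredNinetyFour_partFifteen`, `checkB_fiveHundredNinetyFour_partSixteen`,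 `checkB_fiveHundredNinetyFour_partSeventeen`, `checkB_fiveHundredNinetyFour_partEighteen`, `checkB_fiveHundredNinetyFour_partNineteen`, `checkB_fiveHundredNinetyFour_partTwenty`, `checkB_fiveHundredNinetyFour_partTwentyOne`, `checkB_fiveHundredNinetyFour_partTwentyTwo`, `checkB_fiveHundredNinetyFour_partTwentyThree`, `checkB_fiveHundredNinetyFour_partTwentyFour`, `checkB_fiveHundredNinetyFour_partTwentyFive`, `checkB_fiveHundredNinetyFour_partTwentySix`, `checkB_fiveHundredNinetyFour_partTwentySeven`).
[cite: MeyerNeutsch1981Fermatquadrupel, §2 p. 53 ("alle Fermatquadrupel für N ≤ 614 ermittelt") and Tabelle 1 p. 54 (no row 594)]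
[cite: Aoki1983, Thm. C] [cite: Shioda1982PicardFermat, Prop. 4 (Q′) p. 729] -/
theorem completeAt_fiveHundredNinetyFour : TabelleOneCompleteAt 594 :=
  tabelleOneCompleteAt_of_chunks 594 ([(0, 1), (1, 1), (2, 1), (3, 1), (4, 1), (5, 1), (6, 1)] ++ ([(7, 1), (8, 1), (9, 1), (10, 1), (11, 1), (12, 1), (13, 1)] ++ ([(14, 1), (15, 1), (16, 1), (17, 1), (18, 1), (19, 1), (20, 1)] ++ ([(21, 1), (22, 1), (23, 1), (24, 1), (25, 1), (26, 1), (27, 1)] ++ ([(28, 1), (29, 1), (30, 1), (31, 1), (32, 1), (33, 1), (34, 1)] ++ ([(35, 1), (36, 1), (37, 1), (38, 1), (39, 1), (40, 1), (41, 1)] ++ ([(42, 1), (43, 1), (44, 1), (45, 1), (46, 1), (47, 1)] ++ ([(48, 1), (49, 1), (50, 1), (51, 1), (52, 1), (53, 1), (54, 1)] ++ ([(55, 1), (56, 1), (57, 1), (58, 1), (59, 1), (60, 1), (61, 1)] ++ ([(62, 1), (63, 1), (64, 1), (65, 1), (66, 1), (67, 1), (68, 1)] ++ ([(69, 1), (70,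 1), (71, 1), (72, 1), (73, 1), (74, 1), (75, 1)] ++ ([(76, 1), (77, 1), (78, 1), (79, 1), (80, 1), (81, 1)] ++ ([(82, 1), (83, 1), (84, 1), (85, 1), (86, 1), (87, 1), (88, 1)] ++ ([(89, 1), (90, 1), (91, 1), (92, 1), (93, 1), (94, 1), (95, 1)] ++ ([(96, 1), (97, 1), (98, 1), (99, 1), (100, 1), (101, 1), (102, 1), (103, 1)] ++ ([(104, 1), (105, 1), (106, 1), (107, 1), (108, 1), (109, 1), (110, 1)] ++ ([(111, 1), (112, 1), (113, 1), (114, 1), (115, 1), (116, 1), (117, 1), (118, 1)] ++ ([(119, 1), (120, 1), (121, 1), (122, 1), (123, 1), (124, 1), (125, 1)] ++ ([(126, 1), (127, 1), (128, 1), (129, 1), (130, 1), (131, 1), (132, 1), (133, 1)] ++ ([(134, 1), (135, 1), (136, 1), (137, 1), (138, 1), (139, 1), (140, 1), (141, 1), (142, 1)] ++ ([(143, 1), (144, 1), (145, 1), (146, 1), (147, 1), (148, 1), (149, 1), (150, 1), (151, 1)] ++ ([(152, 1), (153, 1), (154, 1), (155, 1), (156, 1), (157, 1), (158, 1), (159,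 1), (160, 1)] ++ ([(161, 1), (162, 1), (163, 1), (164, 1), (165, 1), (166, 1), (167, 1), (168, 1), (169, 1), (170, 1), (171, 1)] ++ ([(172, 1), (173, 1), (174, 1), (175, 1), (176, 1), (177, 1), (178, 1), (179, 1), (180, 1), (181, 1), (182, 1), (183, 1)] ++ ([(184, 1), (185, 1), (186, 1), (187, 1), (188, 1), (189, 1), (190, 1), (191, 1), (192, 1), (193, 1), (194, 1), (195, 1), (196, 1), (197, 1)] ++ ([(198, 1), (199, 1), (200, 1), (201, 1), (202, 1), (203, 1), (204, 1), (205, 1), (206, 1), (207, 1), (208, 1), (209, 1), (210, 1), (211, 1), (212, 1), (213, 1), (214, 1), (215, 1), (216, 2)] ++ ([(218, 2), (220, 2), (222, 2), (224, 2), (226, 2), (228, 2), (230, 3), (233, 3), (236, 3), (239, 4), (243, 4), (247, 5), (252, 7), (259, 12), (271, 323)]))))))))))))))))))))))))))) (by decide +kernel) (by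
    intro p hp
    rcases List.mem_append.mp hp with hp | hp
    · exact checkB_fiveHundredNinetyFour_partOne p hp
    · rcases List.mem_append.mp hp with hp | hp
      · exact checkB_fiveHundredNinetyFour_partTwo p hp
      · rcases List.mem_append.mp hp with hp | hp
        · exact checkB_fiveHundredNinetyFour_partThree p hp
        · rcases List.mem_append.mp hp with hp | hp
          · exact checkB_fiveHundredNinetyFour_partFour p hp
          · rcases List.mem_append.mp hp with hp | hp
            · exact checkB_fiveHundredNinetyFour_partFive p hp
            · rcases List.mem_append.mp hp with hp | hp
              · exact checkB_fiveHundredNinetyFour_partSix p hp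
              · rcases List.mem_append.mp hp with hp | hp
                · exact checkB_fiveHundredNinetyFour_partSeven p hp
                · rcases List.mem_append.mp hp with hp | hp
                  · exact checkB_fiveHundredNinetyFour_partEight p hp
                  · rcases List.mem_append.mp hp with hp | hp
                    · exact checkB_fiveHundredNinetyFour_partNine p hp
                    · rcases List.mem_append.mp hp with hp | hp
                      · exact checkB_fiveHundredNinetyFour_partTen p hp
                      · rcases List.mem_append.mp hp with hp | hp
                        · exact checkB_fiveHundredNinetyFour_partEleven p hp
                        · rcases List.mem_append.mp hp with hp | hp
                          · exact checkB_fiveHundredNinetyFour_partTwelve p hp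
                          · rcases List.mem_append.mp hp with hp | hp
                            · exact checkB_fiveHundredNinetyFour_partThirteen p hp
                            · rcases List.mem_append.mp hp with hp | hp
                              · exact checkB_fiveHundredNinetyFour_partFourteen p hp
                              · rcases List.mem_append.mp hp with hp | hp
                                · exact checkB_fiveHundredNinetyFour_partFifteen p hp
                                · rcases List.mem_append.mp hp with hp | hp
                                  · exact checkB_fiveHundredNinetyFour_partSixteen p hp
                                  · rcases List.mem_append.mp hp with hp | hp
                                    · exact checkB_fiveHundredNinetyFour_partSeventeen p hp
                                    · rcases List.mem_append.mp hp with hp | hp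
                                      · exact checkB_fiveHundredNinetyFour_partEighteen p hp
                                      · rcases List.mem_append.mp hp with hp | hp
                                        · exact checkB_fiveHundredNinetyFour_partNineteen p hp
                                        · rcases List.mem_append.mp hp with hp | hp
                                          · exact checkB_fiveHundredNinetyFour_partTwenty p hp
                                          · rcases List.mem_append.mp hp with hp | hp
                                            · exact checkB_fiveHundredNinetyFour_partTwentyOne p hp
                                            · rcases List.mem_append.mp hp with hp | hp
                                              · exact checkB_fiveHundredNinetyFour_partTwentyTwo p hp
                                              · rcases List.mem_append.mp hp with hp | hp
                                                · exact checkB_fiveHundredNinetyFour_partTwentyThree p hp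
                                                · rcases List.mem_append.mp hp with hp | hp
                                                  · exact checkB_fiveHundredNinetyFour_partTwentyFour p hp
                                                  · rcases List.mem_append.mp hp with hp | hp
                                                    · exact checkB_fiveHundredNinetyFour_partTwentyFive p hp
                                                    · rcases List.mem_append.mp hp with hp | hp
                                                      · exact checkB_fiveHundredNinetyFour_partTwentySix p hp
                                                      · exact checkB_fiveHundredNinetyFour_partTwentySeven p hp)

/-- **No exceptional quadruple ("Ausnahmequadrupel") at the level `594`** (`tabelleOne 594 = []`).
[cite: MeyerNeutsch1981Fermatquadrupel, Tabelle 1 p. 54 (no row 594)] [cite: Aoki1983, Thm. C] -/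
theorem not_isExceptionalQuadruple_fiveHundredNinetyFour (s : Multiset (ZMod 594)) : ¬ IsExceptionalQuadruple 594 s := by
  intro hs
  obtain ⟨r, hr, -⟩ := exists_mem_reps_of_isExceptionalQuadruple completeAt_fiveHundredNinetyFour hs
  simp [reps, tabelleOne] at hr

end Literature.AlgebraicGeometry.Shioda1982
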